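import Mathlib
import HarnessLib
import Summits.HubbardSuperconductivity.HubbardSuperconductivity.Theorems.KLProgrammeCutCurrencyFactorisation
import Summits.HubbardSuperconductivity.HubbardSuperconductivity.Theorems.KLProgrammeCutCurrencyLegToolkit
import Summits.HubbardSuperconductivity.HubbardSuperconductivity.Theorems.KLProgrammeCutCurrencyProfile

/-!
# Route `KLProgramme` — ENGINE (stmt-HubbardSuperconductivity-20437 `KLRegimeEngineV17F2`), located #25 «(b)-PLAIN-UV-TAIL», cure (α),
# E1 item (i): THE β- AND `M`-EXPLICIT BOUND ON THE ONE-LEG MASS `A(ĝ∘ω)` OF THE UV-CUT VERTEX, AND THE CUT PLAIN CURRENCY BOUND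
# (cell gate-hubbard-kl, seat hubbard-kl-k3c2-p2 g35)

`A(ĝ∘ω) = (2M)⁻¹ Σ_{j ∈ ℤ_{2M}} |Σ_{v ∈ ℤ_{2M}} ĝ(ω_v) e^{−2πivj/(2M)}|`, `ĝ(ω) = gnScaleCutoff 4 klE0 1 |ω| = σ(4/3 − 32|ω|/3)`, `ω_v = π(2(v−M)+1)/β`.
For `128 ≤ β ≤ M` and every integer `J ≥ 1` (**`klct_legMass_uvCut_le`**):

  `A(ĝ∘ω) ≤ (β/(8π) + 1)·(2J+1)/(2M) + C₂(β)·(2M)/(8J)`,   `C₂(β) = 2K(2π/β)²(3β/(32π) + 6)`, `K = 11264/9`,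

from: (mass) `|ĉ(j)| ≤ Σ_v ĝ(ω_v) ≤ β/(8π) + 1` (support count, `klct_sum_uvCutoff_le`); (decay) `|z_j − 1|²|ĉ(j)| ≤ Σ_v|Δ²ĝ| ≤ C₂(β)` (cyclic summation by
parts `…LegToolkit` + the three-point bound `…Profile` + a window count, `klct_secondDiffSum_uvCut_le`) and `|z_j − 1| ≥ 4·dist(j)/2M`; (sum) the discrete
`L¹` lemma.  With `J ≍ M/β^{1/2}`-type choices the right side is β- and `M`-free (numeric corollaries in the sequel); composed with ✓ `…CutCurrencyFactorisation`
(`Θ^cut ≤ A⁴`) it bounds the plain pinned currency of the cut bare vertex, E1 item (i) of located #25 (**`klbv_plainCurrency_uvCut_hubbardInteraction_le_explicit`**).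
No definition; nothing asserts any row, (b), (C), K3, U₀, the window or superconductivity.
References: BGM 2006 §2.2–2.3 [cite: BenfattoGiulianiMastropietro2006]; Zygmund, Trigonometric Series I §II.2 [folklore].
-/

noncomputable section

namespace Summit.HubbardSuperconductivity.HubbardSuperconductivity.Theorems.KLRegimeSplit

set_option linter.dupNamespace false -- summit = problem name (single-conjunct summit), D-0017

open Finset Literature.MathematicalPhysics.QuantumLattice Literature.Probability.LatticeModels GrassmannAlgebra

variable {L M : ℕ} [NeZero M]

/-! ## §1 Cyclic predecessors on `ℤ_{2M}` and the Matsubara samples -/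

/-- `val (v − 1) = val v − 1` when `1 ≤ val v`. -/
theorem klct_val_sub_one {v : ImagTimeIdx M} (hv : 1 ≤ (v : ℕ)) : (((v - 1 : ImagTimeIdx M)) : ℕ) = (v : ℕ) - 1 := by
  have hM := NeZero.ne M
  have h1 : ((1 : ImagTimeIdx M) : ℕ) = 1 := by rw [Fin.val_one']; exact Nat.mod_eq_of_lt (by omega)
  have h := (Fin.coe_sub_iff_le (a := v) (b := 1)).mpr (by rw [Fin.le_def, h1]; exact hv)
  rw [h, h1]

/-- `val (v − 1) = 2M − 1` when `val v = 0`. -/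
theorem klct_val_sub_one_of_zero {v : ImagTimeIdx M} (hv : (v : ℕ) = 0) : (((v - 1 : ImagTimeIdx M)) : ℕ) = 2 * M - 1 := by
  have hM := NeZero.ne M
  have h1 : ((1 : ImagTimeIdx M) : ℕ) = 1 := by rw [Fin.val_one']; exact Nat.mod_eq_of_lt (by omega)
  have h := (Fin.coe_sub_iff_lt (a := v) (b := 1)).mpr (by rw [Fin.lt_def, h1]; omega)
  rw [h, h1, hv]; rfl

/-- Consecutive Matsubara frequencies differ by `2π/β`: `ω_{v−1} = ω_v − 2π/β` (`1 ≤ val v`). -/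
theorem klct_matsubaraFreq_sub_one {β : ℝ} (hβ : β ≠ 0) {v : MatsubaraIdx M} (hv : 1 ≤ (v : ℕ)) :
    matsubaraFreq β M (v - 1) = matsubaraFreq β M v - 2 * Real.pi / β := by
  simp only [matsubaraFreq, matsubaraInt, klct_val_sub_one hv]
  push_cast [Nat.cast_sub hv]
  field_simp
  ring

omit [NeZero M] in
/-- **Edge frequencies are beyond the cut** (`2 ≤ β ≤ M`): `ĝ(ω_w) = 0` for `val w ≤ 1` or `val w ≥ 2M − 2`. -/
theorem klct_uvCutoff_edge_eq_zero {β : ℝ} (hβ : 2 ≤ β) (hM : β ≤ M) (w : MatsubaraIdx M) (hw : (w : ℕ) ≤ 1 ∨ 2 * M ≤ (w : ℕ) + 2) :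
    gnScaleCutoff 4 klE0 1 |matsubaraFreq β M w| = 0 := by
  have hβ0 : 0 < β := by linarith
  have hM2 : (2 : ℝ) ≤ M := hβ.trans hM
  have hwN := w.isLt
  rw [klct_uvCutoff_eq_profile]
  apply klct_profile_eq_zero
  rw [matsubaraFreq, matsubaraInt, abs_div, abs_of_pos hβ0, le_div_iff₀ hβ0, abs_mul, abs_of_pos Real.pi_pos]
  have hpi := Real.pi_gt_three
  have hkey : 2 * (M : ℝ) - 3 ≤ |2 * (((w : ℕ) : ℤ) - M : ℤ) + (1 : ℝ)| := by
    push_cast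
    rcases hw with hw | hw
    · have : ((w : ℕ) : ℝ) ≤ 1 := by exact_mod_cast hw
      rw [abs_of_nonpos (by linarith)]; linarith
    · have : 2 * (M : ℝ) ≤ ((w : ℕ) : ℝ) + 2 := by exact_mod_cast hw
      rw [abs_of_nonneg (by linarith)]; linarith
  nlinarith

/-- `0 ≤ ĝ ≤ 1`. -/
theorem klct_uvCutoff_mem_Icc (y : ℝ) : gnScaleCutoff 4 klE0 1 y ∈ Set.Icc (0 : ℝ) 1 := by
  rw [gnScaleCutoff]; exact gnCutoff_mem_Icc _ _ _

/-! ## §2 Counting integers in a real window -/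

/-- Integers in a real open interval: `n ∈ (α, γ) ⟺ n ∈ Ioo ⌊α⌋ ⌈γ⌉`. -/
theorem klct_mem_Ioo_floor_ceil {α γ : ℝ} {n : ℤ} (h1 : α < n) (h2 : (n : ℝ) < γ) : n ∈ Finset.Ioo ⌊α⌋ ⌈γ⌉ := by
  rw [Finset.mem_Ioo]
  exact ⟨Int.floor_lt.mpr h1, Int.lt_ceil.mpr h2⟩

/-- …and there are at most `γ − α + 1` of them (`α − 1 ≤ γ`). -/
theorem klct_card_Ioo_floor_ceil_le {α γ : ℝ} (h : α - 1 ≤ γ) : (((Finset.Ioo ⌊α⌋ ⌈γ⌉).card : ℕ) : ℝ) ≤ γ - α + 1 := by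
  rw [Int.card_Ioo]
  have h1 : ((⌈γ⌉ : ℤ) : ℝ) < γ + 1 := Int.ceil_lt_add_one γ
  have h2 : α - 1 < ((⌊α⌋ : ℤ) : ℝ) := Int.sub_one_lt_floor α
  have h3 : (((⌈γ⌉ - ⌊α⌋ - 1).toNat : ℤ) : ℝ) = max (((⌈γ⌉ - ⌊α⌋ - 1 : ℤ) : ℝ)) 0 := by
    rw [Int.toNat_eq_max]; push_cast; rfl
  have h4 : ((((⌈γ⌉ - ⌊α⌋ - 1).toNat : ℕ) : ℝ)) = (((⌈γ⌉ - ⌊α⌋ - 1).toNat : ℤ) : ℝ) := by norm_cast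
  rw [h4, h3]
  apply max_le
  · push_cast; linarith
  · linarith

/-! ## §3 The support count: `Σ_v ĝ(ω_v) ≤ β/(8π) + 1` -/

omit [NeZero M] in
/-- **Support count**: `Σ_{v ∈ ℤ_{2M}} ĝ(ω_v) ≤ β/(8π) + 1` (`0 < β`): `ĝ ≤ 𝟙[|ω| < 1/8]` and `|ω_v| < 1/8 ⟺ −β/(8π) < 2n′+1 < β/(8π)`. -/
theorem klct_sum_uvCutoff_le {β : ℝ} (hβ : 0 < β) :
    ∑ v : MatsubaraIdx M, gnScaleCutoff 4 klE0 1 |matsubaraFreq β M v| ≤ β / (8 * Real.pi) + 1 := by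
  classical
  have hpi := Real.pi_pos
  set X : ℝ := β / (8 * Real.pi) with hX
  have hX0 : 0 < X := by positivity
  set V := (univ : Finset (MatsubaraIdx M)).filter (fun v => |matsubaraFreq β M v| < 1 / 8) with hV
  -- `ĝ(ω_v) ≤ 𝟙[v ∈ V]`
  have hpt : ∀ v : MatsubaraIdx M, gnScaleCutoff 4 klE0 1 |matsubaraFreq β M v| ≤ if v ∈ V then 1 else 0 := by
    intro v
    split_ifs with hv
    · exact (klct_uvCutoff_mem_Icc _).2
    · have hge : 1 / 8 ≤ |matsubaraFreq β M v| := by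
        by_contra hlt; push Not at hlt; exact hv (Finset.mem_filter.mpr ⟨Finset.mem_univ _, hlt⟩)
      rw [klct_uvCutoff_eq_profile, klct_profile_eq_zero hge]
  refine (Finset.sum_le_sum (fun v _ => hpt v)).trans ?_
  rw [Finset.sum_ite_mem, Finset.univ_inter, Finset.sum_const, nsmul_eq_mul, mul_one]
  -- inject `V` into the integers of `(−(X+1)/2, (X−1)/2)`
  have hmaps : ∀ v ∈ V, (matsubaraInt M v) ∈ Finset.Ioo ⌊(-(X + 1) / 2 : ℝ)⌋ ⌈((X - 1) / 2 : ℝ)⌉ := by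
    intro v hv
    have hlt := (Finset.mem_filter.mp hv).2
    rw [matsubaraFreq, abs_div, abs_of_pos hβ, div_lt_iff₀ hβ, abs_mul, abs_of_pos hpi] at hlt
    have h' : |2 * ((matsubaraInt M v : ℤ) : ℝ) + 1| < X := by
      rw [hX, lt_div_iff₀ (by positivity)]; nlinarith
    rw [abs_lt] at h'
    apply klct_mem_Ioo_floor_ceil
    · linarith [h'.1]
    · linarith [h'.2]
  have hinj : Set.InjOn (fun v : MatsubaraIdx M => matsubaraInt M v) (V : Set (MatsubaraIdx M)) := by
    intro a _ b _ hab
    simp only [matsubaraInt] at hab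
    exact Fin.ext (by exact_mod_cast (by linarith : ((a : ℕ) : ℤ) = b))
  have hcard := Finset.card_le_card_of_injOn _ hmaps hinj
  have hcardR : ((V.card : ℕ) : ℝ) ≤ (((Finset.Ioo ⌊(-(X + 1) / 2 : ℝ)⌋ ⌈((X - 1) / 2 : ℝ)⌉).card : ℕ) : ℝ) := by exact_mod_cast hcard
  refine hcardR.trans ((klct_card_Ioo_floor_ceil_le (by linarith)).trans (le_of_eq ?_))
  ring

/-! ## §4 The second-difference sum: `Σ_v |Δ²ĝ(ω_·)| ≤ C₂(β)` -/

/-- **The cyclic second-difference sum of the cut samples** (`128 ≤ β ≤ M`, spacing `δ = 2π/β ≤ 1/16`):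
`Σ_{v ∈ ℤ_{2M}} |ĝ(ω_{v−2}) − 2ĝ(ω_{v−1}) + ĝ(ω_v)| ≤ 2K(2π/β)²·(3β/(32π) + 6)`, `K = 11264/9` — each term is `≤ 2Kδ²` and vanishes unless the centre
`ω_{v−1}` lies in the window `1/32 − δ < |·| < 1/8 + δ`, which holds for at most `3β/(32π) + 6` indices; the two wrap-around terms vanish (edge frequencies). -/
theorem klct_secondDiffSum_uvCut_le {β : ℝ} (hβ : 128 ≤ β) (hM : β ≤ M) :
    ∑ v : MatsubaraIdx M, ‖(((gnScaleCutoff 4 klE0 1 |matsubaraFreq β M (v - 1 - 1)| : ℝ) : ℂ)) - 2 * (((gnScaleCutoff 4 klE0 1 |matsubaraFreq β M (v - 1)| : ℝ) : ℂ)) +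
        (((gnScaleCutoff 4 klE0 1 |matsubaraFreq β M v| : ℝ) : ℂ))‖ ≤
      2 * (11264 / 9) * (2 * Real.pi / β) ^ 2 * (3 * β / (32 * Real.pi) + 6) := by
  classical
  have hβ0 : 0 < β := by linarith
  have hβ2 : (2 : ℝ) ≤ β := by linarith
  have hpi := Real.pi_pos
  have hpi3 := Real.pi_gt_three
  have hpi4 := Real.pi_lt_four
  set δ : ℝ := 2 * Real.pi / β with hδ
  have hδ0 : 0 < δ := by positivity
  have hδ' : δ ≤ 1 / 16 := by rw [hδ, div_le_iff₀ hβ0]; nlinarith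
  -- the window of centres
  set W := (univ : Finset (MatsubaraIdx M)).filter (fun v : MatsubaraIdx M => 2 ≤ (v : ℕ) ∧
      (1 / 32 < |matsubaraFreq β M v - δ| + δ ∧ |matsubaraFreq β M v - δ| < 1 / 8 + δ)) with hW
  -- pointwise bound
  have hpt : ∀ v : MatsubaraIdx M,
      ‖(((gnScaleCutoff 4 klE0 1 |matsubaraFreq β M (v - 1 - 1)| : ℝ) : ℂ)) - 2 * (((gnScaleCutoff 4 klE0 1 |matsubaraFreq β M (v - 1)| : ℝ) : ℂ)) +
          (((gnScaleCutoff 4 klE0 1 |matsubaraFreq β M v| : ℝ) : ℂ))‖ ≤ 2 * (11264 / 9) * δ ^ 2 * (if v ∈ W then 1 else 0) := by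
    intro v
    have hnorm : ∀ a b c : ℝ, ‖((a : ℝ) : ℂ) - 2 * ((b : ℝ) : ℂ) + ((c : ℝ) : ℂ)‖ = |a - 2 * b + c| := by
      intro a b c
      rw [show ((a : ℝ) : ℂ) - 2 * ((b : ℝ) : ℂ) + ((c : ℝ) : ℂ) = (((a - 2 * b + c : ℝ)) : ℂ) by push_cast; ring, Complex.norm_real, Real.norm_eq_abs]
    rw [hnorm]
    by_cases hv2 : 2 ≤ (v : ℕ)
    · -- interior: a genuine three-point stencil centred at `y₀ = ω_{v−1} = ω_v − δ`
      have hv1 : 1 ≤ (v : ℕ) := by omega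
      have hv1' : 1 ≤ (((v - 1 : MatsubaraIdx M)) : ℕ) := by rw [klct_val_sub_one hv1]; omega
      have e1 : matsubaraFreq β M (v - 1) = matsubaraFreq β M v - δ := klct_matsubaraFreq_sub_one hβ0.ne' hv1
      have e2 : matsubaraFreq β M (v - 1 - 1) = matsubaraFreq β M v - δ - δ := by
        rw [klct_matsubaraFreq_sub_one hβ0.ne' hv1', e1]
      rw [e1, e2, klct_uvCutoff_eq_profile, klct_uvCutoff_eq_profile, klct_uvCutoff_eq_profile]
      have hind := klct_absProfile_secondDiff_indicator (matsubaraFreq β M v - δ) hδ0 hδ'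
      rw [show matsubaraFreq β M v - δ + δ = matsubaraFreq β M v by ring] at hind
      have hwin : (if 1 / 32 < |matsubaraFreq β M v - δ| + δ ∧ |matsubaraFreq β M v - δ| < 1 / 8 + δ then (1:ℝ) else 0) = (if v ∈ W then 1 else 0) := by
        simp only [hW, Finset.mem_filter, Finset.mem_univ, true_and, hv2]
      rw [← hwin]
      rwa [show Real.smoothTransition (4 / 3 - 32 / 3 * |matsubaraFreq β M v - δ - δ|) - 2 * Real.smoothTransition (4 / 3 - 32 / 3 * |matsubaraFreq β M v - δ|) +
          Real.smoothTransition (4 / 3 - 32 / 3 * |matsubaraFreq β M v|) = Real.smoothTransition (4 / 3 - 32 / 3 * |matsubaraFreq β M v|) -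
          2 * Real.smoothTransition (4 / 3 - 32 / 3 * |matsubaraFreq β M v - δ|) + Real.smoothTransition (4 / 3 - 32 / 3 * |matsubaraFreq β M v - δ - δ|) by ring]
    · -- the two wrap-around terms: every sample involved is an edge frequency
      push Not at hv2
      have hvW : v ∉ W := by
        intro hmem; have := (Finset.mem_filter.mp hmem).2.1; omega
      rw [if_neg hvW, mul_zero]
      have z0 : gnScaleCutoff 4 klE0 1 |matsubaraFreq β M v| = 0 := klct_uvCutoff_edge_eq_zero hβ2 hM v (Or.inl (by omega))
      have hv1val : (((v - 1 : MatsubaraIdx M)) : ℕ) = 0 ∨ (((v - 1 : MatsubaraIdx M)) : ℕ) = 2 * M - 1 := by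
        rcases Nat.lt_or_ge (v : ℕ) 1 with h0 | h1
        · right; exact klct_val_sub_one_of_zero (by omega)
        · left; rw [klct_val_sub_one h1]; omega
      have hM1 := NeZero.ne M
      have z1 : gnScaleCutoff 4 klE0 1 |matsubaraFreq β M (v - 1)| = 0 :=
        klct_uvCutoff_edge_eq_zero hβ2 hM (v - 1) (by rcases hv1val with h | h <;> omega)
      have hv11val : (((v - 1 - 1 : MatsubaraIdx M)) : ℕ) = 2 * M - 1 ∨ (((v - 1 - 1 : MatsubaraIdx M)) : ℕ) = 2 * M - 2 := by
        rcases hv1val with h | h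
        · left; exact klct_val_sub_one_of_zero h
        · right; rw [klct_val_sub_one (by omega), h]; omega
      have z2 : gnScaleCutoff 4 klE0 1 |matsubaraFreq β M (v - 1 - 1)| = 0 :=
        klct_uvCutoff_edge_eq_zero hβ2 hM (v - 1 - 1) (by rcases hv11val with h | h <;> omega)
      rw [z0, z1, z2]; norm_num
  refine (Finset.sum_le_sum (fun v _ => hpt v)).trans ?_
  rw [← Finset.mul_sum, Finset.sum_ite_mem, Finset.univ_inter, Finset.sum_const, nsmul_eq_mul, mul_one]
  gcongr
  -- the window count: inject `W` by `v ↦ n″ = matsubaraInt v − 1` into two integer intervals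
  set P : ℝ := (1 / 32 - δ) * β / Real.pi with hP
  set Q : ℝ := (1 / 8 + δ) * β / Real.pi with hQ
  have hQP : Q - P = 3 * β / (32 * Real.pi) + 4 := by
    rw [hQ, hP, hδ]; field_simp; ring
  set T₁ : Finset ℤ := Finset.Ioo ⌊((P - 1) / 2 : ℝ)⌋ ⌈((Q - 1) / 2 : ℝ)⌉ with hT₁
  set T₂ : Finset ℤ := Finset.Ioo ⌊((-Q - 1) / 2 : ℝ)⌋ ⌈((-P - 1) / 2 : ℝ)⌉ with hT₂
  have hmaps : ∀ v ∈ W, (matsubaraInt M v - 1) ∈ T₁ ∪ T₂ := by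
    intro v hv
    obtain ⟨hv2, hw1, hw2⟩ := (Finset.mem_filter.mp hv).2
    -- the centre is `π(2n″+1)/β`
    have hc : matsubaraFreq β M v - δ = Real.pi * (2 * ((matsubaraInt M v - 1 : ℤ) : ℝ) + 1) / β := by
      rw [matsubaraFreq, hδ]; push_cast; field_simp; ring
    rw [hc, abs_div, abs_of_pos hβ0, abs_mul, abs_of_pos hpi] at hw1 hw2
    set m : ℤ := matsubaraInt M v - 1 with hm
    have hw1' : P < |2 * (m : ℝ) + 1| := by
      rw [hP, div_lt_iff₀ hpi]
      have := hw1; rw [div_add' _ _ _ hβ0.ne', lt_div_iff₀ hβ0] at this; nlinarith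
    have hw2' : |2 * (m : ℝ) + 1| < Q := by
      rw [hQ, lt_div_iff₀ hpi]
      have := hw2; rw [div_lt_iff₀ hβ0] at this; nlinarith
    rw [Finset.mem_union]
    rcases le_or_gt 0 (2 * (m : ℝ) + 1) with hs | hs
    · left
      rw [abs_of_nonneg hs] at hw1' hw2'
      exact klct_mem_Ioo_floor_ceil (by linarith) (by linarith)
    · right
      rw [abs_of_neg hs] at hw1' hw2'
      exact klct_mem_Ioo_floor_ceil (by linarith) (by linarith)
  have hinj : Set.InjOn (fun v : MatsubaraIdx M => matsubaraInt M v - 1) (W : Set (MatsubaraIdx M)) := by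
    intro a _ b _ hab
    simp only [matsubaraInt] at hab
    exact Fin.ext (by exact_mod_cast (by linarith : ((a : ℕ) : ℤ) = b))
  have hcard := (Finset.card_le_card_of_injOn _ hmaps hinj).trans (Finset.card_union_le T₁ T₂)
  have hcardR : ((W.card : ℕ) : ℝ) ≤ ((T₁.card : ℕ) : ℝ) + ((T₂.card : ℕ) : ℝ) := by exact_mod_cast hcard
  have hPQ : P ≤ Q := by linarith [show (0:ℝ) < 3 * β / (32 * Real.pi) + 4 by positivity]
  have h1 : ((T₁.card : ℕ) : ℝ) ≤ (Q - 1) / 2 - (P - 1) / 2 + 1 := klct_card_Ioo_floor_ceil_le (by linarith)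
  have h2 : ((T₂.card : ℕ) : ℝ) ≤ (-P - 1) / 2 - (-Q - 1) / 2 + 1 := klct_card_Ioo_floor_ceil_le (by linarith)
  linarith

/-! ## §5 THE LEG-MASS BOUND -/

/-- **THE ONE-LEG MASS OF THE UV-CUT VERTEX, β- AND `M`-EXPLICITLY** (E1 item (i) of located #25; `128 ≤ β ≤ M`, any integer `J ≥ 1`):
`(2M)⁻¹ Σ_j |Σ_v ĝ(ω_v) e^{−2πivj/(2M)}| ≤ (β/(8π) + 1)(2J+1)/(2M) + [2K(2π/β)²(3β/(32π)+6)]·(2M)/(8J)`, `K = 11264/9`.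
Ingredients: `|ĉ(j)| ≤ Σ_vĝ(ω_v)` (support count), `(4·dist(j)/2M)²|ĉ(j)| ≤ |z_j−1|²|ĉ(j)| ≤ Σ|Δ²ĝ|` (gap + cyclic summation by parts + three-point bound),
and the discrete `L¹` lemma. -/
theorem klct_legMass_uvCut_le {β : ℝ} (hβ : 128 ≤ β) (hM : β ≤ M) {J : ℕ} (hJ : 1 ≤ J) :
    (((2 * M : ℕ) : ℝ))⁻¹ * ∑ j : ImagTimeIdx M, ‖∑ n : MatsubaraIdx M, (((gnScaleCutoff 4 klE0 1 |matsubaraFreq β M n| : ℝ) : ℂ)) *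
        Complex.exp (-((2 * Real.pi * ((n : ℕ) : ℝ) * ((j : ℕ) : ℝ) / (2 * M) : ℝ) : ℂ) * Complex.I)‖ ≤
      (β / (8 * Real.pi) + 1) * (2 * J + 1) / ((2 * M : ℕ) : ℝ) +
        (2 * (11264 / 9) * (2 * Real.pi / β) ^ 2 * (3 * β / (32 * Real.pi) + 6)) * ((2 * M : ℕ) : ℝ) / (8 * J) := by
  have hβ0 : 0 < β := by linarith
  have hMne := NeZero.ne M
  have hN : 0 < 2 * M := by omega
  have hNr : (0 : ℝ) < ((2 * M : ℕ) : ℝ) := by exact_mod_cast hN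
  have hcast : (2 * (M : ℝ)) = ((2 * M : ℕ) : ℝ) := by push_cast; ring
  have hJr : (0 : ℝ) < J := by exact_mod_cast hJ
  -- the samples and the root of unity
  set f : MatsubaraIdx M → ℂ := fun n => (((gnScaleCutoff 4 klE0 1 |matsubaraFreq β M n| : ℝ) : ℂ)) with hf
  set z : ImagTimeIdx M → ℂ := fun j => Complex.exp (-((2 * Real.pi * ((j : ℕ) : ℝ) / ((2 * M : ℕ) : ℝ) : ℝ) : ℂ) * Complex.I) with hz
  have hzN : ∀ j, z j ^ (2 * M) = 1 := fun j => klct_rootOfUnity_pow (N := 2 * M) (j : ℕ)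
  have hz1 : ∀ j, ‖z j‖ = 1 := fun j => klct_norm_eq_one_of_pow_eq_one (by omega) (hzN j)
  have hphase : ∀ (n : MatsubaraIdx M) (j : ImagTimeIdx M),
      Complex.exp (-((2 * Real.pi * ((n : ℕ) : ℝ) * ((j : ℕ) : ℝ) / (2 * M) : ℝ) : ℂ) * Complex.I) = z j ^ (n : ℕ) := by
    intro n j
    rw [hcast]
    exact klct_legPhase_eq_pow (N := 2 * M) (n : ℕ) (j : ℕ)
  simp_rw [hphase]
  set h : ImagTimeIdx M → ℝ := fun j => ‖∑ n : MatsubaraIdx M, f n * z j ^ (n : ℕ)‖ with hh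
  -- (mass) `h ≤ S`
  set S : ℝ := β / (8 * Real.pi) + 1 with hS
  have hS0 : 0 ≤ S := by positivity
  have hle : ∀ j, h j ≤ S := by
    intro j
    refine (norm_sum_le _ _).trans ?_
    have : ∀ n : MatsubaraIdx M, ‖f n * z j ^ (n : ℕ)‖ = gnScaleCutoff 4 klE0 1 |matsubaraFreq β M n| := by
      intro n
      rw [norm_mul, norm_pow, hz1 j, one_pow, mul_one, hf, Complex.norm_real, Real.norm_eq_abs, abs_of_nonneg (klct_uvCutoff_mem_Icc _).1]
    simp_rw [this]
    exact klct_sum_uvCutoff_le hβ0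
  -- (decay) `h(j)·dist(j)² ≤ C₂ N²/16`
  set C₂ : ℝ := 2 * (11264 / 9) * (2 * Real.pi / β) ^ 2 * (3 * β / (32 * Real.pi) + 6) with hC₂
  have hC₂0 : 0 ≤ C₂ := by positivity
  have hdec : ∀ j : ImagTimeIdx M, ((j : ℕ)) ≠ 0 → h j * (min ((j : ℕ) : ℝ) (((2 * M : ℕ) : ℝ) - (j : ℕ))) ^ 2 ≤ C₂ * ((2 * M : ℕ) : ℝ) ^ 2 / 16 := by
    intro j _
    have hgap := klct_rootOfUnity_gap (N := 2 * M) hN j.isLt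
    have hsbp := klct_normSq_mul_norm_sum_le_secondDiff f (z j) (hzN j)
    have hC : ∑ v : MatsubaraIdx M, ‖f (v - 1 - 1) - 2 * f (v - 1) + f v‖ ≤ C₂ := klct_secondDiffSum_uvCut_le hβ hM
    have hmin0 : 0 ≤ min ((j : ℕ) : ℝ) (((2 * M : ℕ) : ℝ) - (j : ℕ)) := by
      apply le_min (by positivity)
      have : ((j : ℕ) : ℝ) < ((2 * M : ℕ) : ℝ) := by exact_mod_cast j.isLt
      linarith
    have h0 : 0 ≤ h j := norm_nonneg _
    -- `(4 m / N)² h ≤ ‖z − 1‖² h ≤ C₂`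
    have hstep : (4 * min ((j : ℕ) : ℝ) (((2 * M : ℕ) : ℝ) - (j : ℕ)) / ((2 * M : ℕ) : ℝ)) ^ 2 * h j ≤ C₂ := by
      calc _ ≤ ‖z j - 1‖ ^ 2 * h j := by
            apply mul_le_mul_of_nonneg_right _ h0
            exact pow_le_pow_left₀ (by positivity) hgap 2
        _ ≤ _ := hsbp.trans hC
    rw [div_pow, div_mul_eq_mul_div, div_le_iff₀ (by positivity)] at hstep
    nlinarith
  -- (sum) the discrete L¹ lemma
  have hsum := klct_sum_le_of_sq_decay (N := 2 * M) h hS0 (by positivity : 0 ≤ C₂ * ((2 * M : ℕ) : ℝ) ^ 2 / 16) hle hdec hJ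
  -- divide by `N`
  rw [inv_mul_le_iff₀ hNr]
  refine hsum.trans (le_of_eq ?_)
  field_simp
  ring

/-! ## §6 Composition with the factorisation: the cut plain currency, explicitly -/

/-- **THE PLAIN PINNED CURRENCY OF THE UV-CUT BARE VERTEX, β- AND `M`-EXPLICITLY** (E1 item (i) of located #25 cure (α); `128 ≤ β ≤ M`, `J ≥ 1`):
`ε_x³ Σ_{x′: x′_q = y}‖W₄(S_ĝ V)(x′)‖ ≤ (|U|/24)·B(β, M, J)⁴` with `B` the right side of `klct_legMass_uvCut_le`. -/
theorem klbv_plainCurrency_uvCut_hubbardInteraction_le_explicit [NeZero L] {β : ℝ} (hβ : 128 ≤ β) (hM : β ≤ M) (U : ℝ) (q : Fin 4) (y : SpaceTimeIdx L M)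
    {J : ℕ} (hJ : 1 ≤ J) :
    imagTimeWeight β M ^ 3 *
        ∑ x ∈ univ.filter (fun x : Fin 4 → SpaceTimeIdx L M => x q = y),
          ‖sectorisedKernel L M β (trivialMultiplier L M)
            (ExteriorAlgebra.map (LinearMap.mulLeft ℂ (fun K : HubbardFieldIdx L M => ((gnScaleCutoff 4 klE0 1 |matsubaraFreq β M K.1.1.1| : ℝ) : ℂ))) (hubbardInteraction L M β U)) 4
            (![(((0 : Fin 1), (0 : Fin 2)), (0 : Fin 2)), ((0, 0), 1), ((0, 1), 0), ((0, 1), 1)] : Fin 4 → SectorLeg 1) x‖ ≤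
      |U| / 24 * ((β / (8 * Real.pi) + 1) * (2 * J + 1) / ((2 * M : ℕ) : ℝ) +
        (2 * (11264 / 9) * (2 * Real.pi / β) ^ 2 * (3 * β / (32 * Real.pi) + 6)) * ((2 * M : ℕ) : ℝ) / (8 * J)) ^ 4 := by
  refine (klbv_plainCurrency_uvCut_hubbardInteraction_le_legMass_pow_four (by linarith) hM U q y).trans ?_
  have hA0 : 0 ≤ (((2 * M : ℕ) : ℝ))⁻¹ * ∑ j : ImagTimeIdx M, ‖∑ n : MatsubaraIdx M, (((gnScaleCutoff 4 klE0 1 |matsubaraFreq β M n| : ℝ) : ℂ)) *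
      Complex.exp (-((2 * Real.pi * ((n : ℕ) : ℝ) * ((j : ℕ) : ℝ) / (2 * M) : ℝ) : ℂ) * Complex.I)‖ :=
    mul_nonneg (inv_nonneg.mpr (by positivity)) (Finset.sum_nonneg (fun _ _ => norm_nonneg _))
  gcongr
  exact klct_legMass_uvCut_le hβ hM hJ

end Summit.HubbardSuperconductivity.HubbardSuperconductivity.Theorems.KLRegimeSplit

end
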